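import Mathlib
import HarnessLib
import HarnessLib.Audit
import Summits.CriticalPhenomena.Statement
import Literature.Probability.LatticeModels.GibbsSpecification
import HarnessLib.Audit.Status.Attr

/-!
Route: SynchronousCoupling

DORMANT since 2026-08-26T12:05:56Z (reconciler: no traction for 8 d (last activity item-evidence-added at 2026-08-18T11:10:31Z); parked, not closed — `ledger route dormant route-CriticalPhenomena-SynchronousCoupling --off` to reactivate) — unstaffed, not closed; items shared with open routes are served there. `ledger route dormant <id> --off` reactivates.

# Route SynchronousCoupling — Cauchy by coupling — cross-scale and cross-rotation joinings of the
critical measure, witnessed by common-noise Kac–Siegert dynamics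

It suffices to show X_SC := (DJ) ∧ (RJ) ∧ (UR) ∧ (JT) ∧ (IUN) ∧ (R4NG), realising card
kac-siegert-cross-mesh-synchronisation
(spine, sole card; critic grade new-mechanism) with its cruxes re-typed at the level of LAWS. The
new object is a JOINING: a
coupling π of the (unique) critical Gibbs measure μ_c of the n.n. Ising model on ℤ³ WITH ITSELF
under which the self-normalised
block spins at block side p·b of the first copy and at side b of the second copy agree in L²(π) up
to C·b^(−θ), p ∈ {2,3}
(DJ, DilationJoinings: "dilation by p is an L²-approximate factor of μ_c at large scales"), and the
same for the rational
rotation T = A/3 ∈ SO(3)∖B₃, A = ((2,2,−1),(−1,2,2),(2,−1,2)): block spins over the lattice points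
of the rotated cubes
T⁻¹(n(u+[0,1)³)) of copy 1 agree with the axis n-blocks of copy 2 up to C·n^(−θ) (RJ,
RotationJoining). JT (JoiningsTransfer)
is the reduction: DJ + RJ + the shared precompactness crux UR (UniformRegularity, item 4658
verbatim) give the pinned
pointwise limit (item 6153's statement) AND O(3)-invariance of every normalised pointwise scaling
limit; the support item
PinnedLimitConstruction (the statement of the landed
MirrorHoelderLimitConstruction.limitConstruction_proof, hypotheses swapped;
provable now in one line) turns this into the existence data, and the shared imported complements
IUN (1982) and R4NG (0636)
supply inversion covariance and U₄ ≢ 0.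
Lean: `DilationJoinings ∧ RotationJoining ∧ UniformRegularity ∧ JoiningsTransfer ∧
InversionUpgradeNormalised ∧ IsingEuclidUpgradeR4NonGaussian`

## Assembly
The deciding theorem `closes` (glue.lean, certified natively) USES ALL SIX cruxes plus the support
item PinnedLimitConstruction:
JoiningsTransfer applied to DilationJoinings, RotationJoining and UniformRegularity gives (PL) ∧
(ROT); PinnedLimitConstruction
applied to (PL) and UniformRegularity yields ρ, Δ > 0, S with HasPointwiseScalingLimit (criticalCorr
3) ρ S, normalisation,
non-degeneracy, translation invariance and scale covariance; (ROT) gives IsRotationInvariant S,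
hence IsEuclideanInvariant S;
InversionUpgradeNormalised gives IsInversionCovariant Δ S and IsMoebiusCovariant Δ S := ⟨Euclid,
scale, inversion⟩;
IsingEuclidUpgradeR4NonGaussian gives HasNontrivialU4 S; ⟨ρ, Δ, S, …⟩ is CritIsing3DConformalLimit =
Ising3DConformalLimit.
Route-repair 2026-08-17: `closes` no longer calls limitConstruction_proof directly, because
importing
Theorems.MirrorHoelderCompactnessLimitConstruction dragged 45 unproved named Literature facts (lace
expansion, Sweep1,
HighDimTriviality, ONModel specification) into this file's import cone although none is used; the
file now imports only
Summits.CriticalPhenomena.Statement and Literature.Probability.LatticeModels.GibbsSpecification.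
PinnedLimitConstruction is proved by
`fun hPL hUR => limitConstruction_proof hUR hPL` in a Theorems file importing this route file
(planner evidence attached to the item).
The Assembly item records DJ → RJ → UR → JT → IUN → R4NG → Statement and stays provable now by the
original eleven lines.

Rationale: WHY THIS LINE. Every existence route on file either assumes the limit (items 1981/0638/1344 "suppose
the limit exists"), or supplies
COMPACTNESS (MirrorHoelderCompactness, ClusterRigidity) and leaves UNIQUENESS of the cluster point
(PointwiseLimit, item 6153) to
an identification input (CFT rigidity, a Lyapunov function of an RG map, GKS monotonicity of a zoom
orbit, a spectral threshold).
This line supplies uniqueness by a CAUCHY CRITERION IN THE MESH realised through COUPLINGS — the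
architecture with which Kozma
closed existence and rotation invariance of the 3D loop-erased walk (Kozma2007 §6: couple the model
across ℤ³/2ℤ³/3ℤ³ and
across the commensurate rotated lattice, then density of 2^i3^j and of ⟨B₃,T⟩) — with the driving
walk, which Ising lacks,
replaced by the ADDITIVE common noise of the exact Kac–Siegert/Hubbard–Stratonovich Langevin
dynamics dφ = (tanh(Mφ)−φ)dt +
√2·M^(−1/2)dW, M = κ+β_cJ (cooperative drift ⇒ order-preserving synchronous coupling; E tanh(Mφ)_x
tanh(Mφ)_y = ⟨σ_xσ_y⟩ exactly),
read at two meshes or through rotated cells (the card; synchronisation by noise: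
doi:10.1214/16-AOP1088, arXiv:1411.1340,
doi:10.1142/S0219493720400067, doi:10.1214/24-AOP1690; UV cross-mesh anchor doi:10.1214/17-AOP1212).
Imported areas:
synchronisation by noise / order-preserving random dynamical systems, optimal transport (W₂
completeness and gluing turn the
joinings into a Cauchy sequence of block-field laws), Ornstein's joining/d̄ viewpoint from ergodic
theory; the typed cruxes are
law-level (∃ coupling with a power-rate defect), so the dynamics is the attack and canonical
witness, not a hypothesis. No route
among the 52 open ones uses couplings of μ_c with itself, common-noise dynamics, or a
Cauchy-by-coupling existence argument.

RANKED CRUXES. #2 DilationJoinings (crux) — for the (unique, translation-invariant) critical Gibbs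
measure μ of the n.n. Ising model on ℤ³ and p ∈ {2,3} there are C, θ > 0 such that for every block
side b ≥ 1 and window m there is a coupling π of μ with μ under which, for every block index u with
|u_i| ≤ m, the self-normalised block spin of side p·b at corner p·b·u (copy 1) and the
self-normalised block spin of side b at corner b·u (copy 2) differ by at most C·b^(−θ) in L²(π)
(card K1 at law level: "dilation is an L²-approximate factor of μ_c"). [difficulty: open-problem]
(why it might fail: IR-black critical dynamics: the noise GENERATED per octave by the cubic vertex
may be relevant, so no coupling beats a scale-independent defect (critic's toy, L ≤ 16: defect only
×0.85 per octave, r→1 vs saturation undecided); or joinings exist with o(1) defect but no power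
rate.) [Kozma2007, doi:10.1214/16-AOP1088, doi:10.1142/S0219493720400067, doi:10.1214/24-AOP1690,
doi:10.1214/17-AOP1212, doi:10.1214/13-AIHP591, arXiv:2202.02301]
#3 RotationJoining (crux) — for μ as above there are C, θ > 0 such that for every n ≥ 1 and window m
there is a coupling π of μ with μ under which, for every block index u with |u_i| ≤ m, the
self-normalised spin sum of copy 1 over the lattice points x with A·x ∈ 3n(u + [0,1)³) (the cube
n(u+[0,1)³) rotated by T⁻¹, T = A/3 ∈ SO(3)∖B₃, A = ((2,2,−1),(−1,2,2),(2,−1,2)), AᵀA = 9) and the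
self-normalised spin sum of copy 2 over the axis cube n(u + [0,1)³) differ by at most C·n^(−θ) in
L²(π) (card K2: Kozma's commensurate-rotation device with the walk replaced by common noise read
through rotated cells, equal clocks). [difficulty: open-problem] (why it might fail: the
rotated-cell/axis-cell mismatch is an O(1) UV perturbation renewed at every site and nothing
lattice-exact protects it (commensurability is not used); if its generated noise is relevant the
cross-correlation saturates below 1 and no power decay in n holds for any coupling.) [Kozma2007,
arXiv:1811.11685, doi:10.1214/16-AOP1088, doi:10.1142/S0219493720400067, DuminilCopinICM2022]
#4 UniformRegularity (crux) — (shared item 4658 verbatim, routes ClusterRigidity /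
MirrorHoelderCompactness) precompactness of the pinned zoom: for every n and compact K of
non-coincident configurations the rescaled correlators F_n^δ = ρ★(δ)^n⟨∏σ_([x_k/δ])⟩⁺_(β_c), ρ★(δ) =
⟨σ₀σ_(⌊1/δ⌋e₀)⟩^(−1/2), are (a) locally bounded, (b) uniformly equicontinuous for small δ, (c)
bounded below at n = 2. [difficulty: open-problem] (why it might fail: its open inputs are all-scale
two-point doubling (6150: RP/MMS/IR admit crossover profiles breaking it) and equicontinuity at
caged configurations (6152: needs a mixing input); SeparableHoelder and CompactnessGlue are proved,
so it fails exactly if doubling or the caged modulus fails.) [AizenmanDuminilCopinAnnals2021,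
DuminilcopinPanis2025, MessagerMiracleSoleJSP1977, Newman1975Gaussian,
Literature.Probability.LatticeModels.criticalTwoPoint_bounds_holds]
#5 JoiningsTransfer (crux) — the reduction: DilationJoinings → RotationJoining → UniformRegularity →
(PL) ∧ (ROT), where (PL) is item 6153's statement verbatim (for every n and non-coincident x the
pinned rescaled correlator converges as δ → 0⁺) and (ROT) says that every normalised,
non-degenerate, translation-invariant, scale-covariant pointwise scaling limit S of criticalCorr 3
is IsRotationInvariant. Proof plan: block moments are Cauchy along b·p^j by the joinings + the
PROVED Newman Gaussian domination (newman_evenMoment_le_holds) and exists_plusMeasure_holds; the n =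
2 joining at block separation K·e₀ exchanges the block normalisation for ρ★; UR(b) passes from
blocks to points and gives asymptotic log-scale continuity; log 2/log 3 ∉ ℚ gives the full filter
(Kozma2007 §6); RJ + UR(b) give invariance of S under T and B₃, whose closure is O(3) (O_h is a
maximal finite subgroup, T ∉ O_h); two non-degenerate limits differ by κⁿ
(ScaleNotMoebius.tendsto_rescaledCorrelator_unique_upToScalar). [deps: DilationJoinings,
RotationJoining, UniformRegularity] [difficulty: L] (why it might fail: only through the limit
interchange b → ∞ before K → ∞ (needs C uniform in the window m — as typed — and equicontinuity
uniform in δ from UR(b)); the O(3) step needs continuity of S_n on NonCoincident, again from UR(b):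
a bookkeeping risk, expected provable as filed.) [Kozma2007, Newman1975Gaussian,
AizenmanDuminilCopinAnnals2021, Literature.Probability.LatticeModels.newman_evenMoment_le_holds,
Literature.Probability.LatticeModels.exists_plusMeasure_holds,
Literature.Barriers.CriticalPhenomena.ScaleNotMoebius.tendsto_rescaledCorrelator_unique_upToScalar]
#6 InversionUpgradeNormalised (crux) — (shared item 1982 verbatim, routes HyperoctahedralRP /
GaussianScaleMixture / MirrorHoelderCompactness …) every normalised (S = 0 off NonCoincident),
non-degenerate, Euclidean-invariant, scale-covariant pointwise scaling limit of criticalCorr 3 is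
inversion covariant with the same Δ (Polyakov's upgrade, typed with the normalisation demanded by
Theorems/IsingEuclidUpgradeRefutations.lean). [deps: JoiningsTransfer] [difficulty: open-problem]
(why it might fail: scale + Euclid (+ RP) ⇏ inversion in general (free Maxwell d = 3,
ElshowkNakayamaRychkov2011; witnessFamily of ScaleCovarianceNotMoebius); for Ising it rests on the
absence of a Δ = 2 virial current, backed only by non-rigorous RG and Monte-Carlo Δ_V > 5.)
[ElshowkNakayamaRychkov2011, Nakayama2015, DelamotteTissierWschebor2016, PolandRychkovVichi2019,
Literature.Barriers.CriticalPhenomena.ScaleCovarianceNotMoebius]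
#7 IsingEuclidUpgradeR4NonGaussian (crux) — (shared item 0636 verbatim) every non-degenerate
pointwise scaling limit S of the renormalised critical Ising correlators on ℤ³ has connected
four-point function U₄ ≢ 0 on non-coincident configurations (clause (iii), imported; this route does
not attack it — joinings hold in d ≥ 4 too). [difficulty: open-problem] (why it might fail:
non-triviality in d = 3 is open: U₄ ≢ 0 needs the double-current intersection probability at
macroscopic separation to stay > 0 as δ → 0 (Aizenman1982); theorems in print go the other way
(Gaussian limits for d = 4, ADC2021, and for RP long-range models on ℤ³, α ≤ 3/2).)
[AizenmanDuminilCopinAnnals2021, Aizenman1982, DuminilCopinICM2022,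
Literature.Barriers.CriticalPhenomena.LongRangeTrivialityOnZ3,
Literature.Barriers.CriticalPhenomena.IsingTrivialityFromDimensionFour]

TWO-LAYER PLAN. Foreseen glued splits once a crux closes or stalls (k ≤ 3, depth 1):
DilationJoinings ⇐ HSSyncTorus (card K1 typed: uniform-in-L
synchronisation defect of the stationary common-noise HS pair chain on (ℤ/pL)³ × (ℤ/L)³,
bc/DilationJoinings_birth.lean) →
TorusSyncTransfer (readout + h → 0 + L → ∞ + DLR + uniqueness at β_c) → DilationJoinings;
RotationJoining ⇐ HSSyncRotBox (free boxes,
rotated cells with Gram-covariance common noise, equal clocks) → RotBoxTransfer → RotationJoining;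
JoiningsTransfer ⇐
PointwiseFromDilations → RotationTransfer → JoiningsTransfer; UniformRegularity ⇐ TwoPointDoubling →
NonSeparableModulus (its home
route's line, glue proved). Nothing of this is filed now.

KILL CRITERIA. A theorem "no coupling of μ_c with itself has dilation defect → 0" (e.g. from an
IR-blackness / noise-sensitivity statement for the
critical field, or a W₂ lower bound between consecutive block-field laws) refutes DilationJoinings:
close `refuted:DilationJoinings`
and file the blackness statement under Literature/Barriers (it would also bear on every
white-noise-factor construction of the
limit). RotationJoining refuted alone (dilations fine, rotation not): pivot to DJ + imported
isotropy (HRP2Rigidity /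
LimitRotationInvariant of HyperoctahedralRP) — the route keeps existence. UniformRegularity refuted:
every compactness-based existence
route dies with it; this route pivots to a smeared (field-level, crit-ising.S02) target.
PointwiseLimit (6153) proved elsewhere moots
DJ's role in existence but not RJ's (isotropy). JoiningsTransfer refuted as typed ⇒ misstated
(repair the limit-interchange clause).

NOT DECOMPOSED YET. The dynamics-level witnesses (HSSyncTorus, HSSyncRotBox: κ > 6β_c, clock
exponent z, Euler step h, square-root factors Q of M⁻¹,
Gram factor B of the cell-overlap covariance), the thermodynamic-limit transfers, the
normalisation-exchange and Croft/log-density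
lemmas inside JoiningsTransfer, and the p = 2 vs p = 3 cases are all layer-2 children or prover
lemmas (`--supports`), not items.
No inversion joining is filed (the card's K3 lives in infinite volume with a position-dependent
clock; inversion is imported via 1982).

CHEAPEST FALSIFIER. Monte Carlo of the CANONICAL WITNESS with common random numbers (one number per
scale, tiny variance): the preconditioned HS Euler
pair chain on (ℤ/2L)³ × (ℤ/L)³ at β_c = 0.2216546, κ ≈ 1.4, clock ratio 2^z (z ≈ 2.02), block-summed
noise; r(b) := pooled
correlation of normalised tanh(Mφ)-block means, defect 1 − r(b). The critic's re-implementation at L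
= 16 (kit j015660–2, j015782,
j016451, j015813; 3 seeds × 4·10⁴ t.u.) gave r = 0.745, 0.791, 0.816, 0.842, 0.869 for b = 1, 2, 4,
8, 16, rising with b and L
(0.63 → 0.77 → 0.87 for L = 4, 8, 16), all controls falling (β = 0: 0.62 flat; β = 0.18: 0.735 →
0.698; clock mismatch: 0.608 →
0.391). KILL: at L = 32, 64 the defect 1 − r(L/2) stops decreasing (saturation) — then DJ is dead
for the canonical witness and
very likely false; ALIVE: 1 − r(L/2) keeps shrinking by a fixed factor per octave (θ > 0). Second,
in-law falsifier needing no
dynamics: the dimensionless block-spin ratios Q_b = ⟨S_b⁴⟩/⟨S_b²⟩² (Binder) at b and 2b must differ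
by O(b^(−θ)); a non-convergent
Q_b (log-periodic drift) kills DJ outright.

NUMBERS. β_c(ℤ³) = 0.221654626(5); Δ_σ = 0.5181489(10), η = 0.036298(2), ω = 0.82968(23), Δ_ε =
1.412625(10) (bootstrap); dynamic exponent
of model A in 3D Ising z ≈ 2.024; Gaussian anchor: for the massless lattice GFF the spectral
coupling gives dilation joinings with
θ = 2 (dispersion mismatch O(p²) weighted by the block form factor), and at β = 0 (i.i.d. spins)
quantile coupling of block sums
gives θ = 3 (W₂-CLT rate); toy (critic, L ≤ 16): defect ×0.85 per octave ⇒ θ_eff ≈ 0.23. Items at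
open: 6 (all cruxes).

DEFINITION REQUESTS. After open: `ledger workitem add --kind definition --notion HSLangevinPairChain
--topic Summits/CriticalPhenomena/Ising3DConformalLimit/Theorems`
for the objects typed in bc/DilationJoinings_birth.lean and bc/RotationJoining_birth.lean (Mop/Mfree
= κ·1 + β·J, drift = tanh(M·) − id,
eulerStep, blockNoise / Gram-factor cell noise, pairStep, IsStationaryPair, tanhBlock /
rotTanhBlock), so that the layer-2 children
HSSyncTorus / HSSyncRotBox can be filed with signatures. No Literature notion is missing for the six
items (isingGibbsMeasures,
IsTranslationInvariantMeasure, Measure.fst/snd, spinAt, rescaledCorrelator, criticalCorr all exist).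

Novelty: Searches (2026-08-17): keyword scan of all 52 open routes' theses/mechanisms (open_routes.json) and
of the 125 cards of the sub
(`ledger idea list --status all`): 0 routes with couplings/joinings/common noise/synchronisation;
the only card is the spine
(critic 2281: new-mechanism, unrouted). `lit search --source zbmath` ×8 ("synchronization by noise
order-preserving" → FGS 2017,
Butkovsky–Scheutzow 2020; "Wasserstein distance renormalization group" → Lacoin–Rhodes–Vargas UV
only; "d-bar distance Gibbs random
fields" 0; "Kantorovich distance scaling limit lattice field" 0; "coupling from the past critical
Ising" → heat-bath FK coupling
times, same-system; "optimal transport coarse-graining lattice" 0; "renormalization group optimal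
transport" 0 relevant;
"loop-erased random walk three dimensions scaling limit" → Kozma 2007, Li–Shiraishi 2019–2025); `lit
galaxy search
"synchronization by noise" --star all` (7 rows: FGS, Gess, iterated function systems — all
same-system); `lit galaxy search
"coupling two lattice spacings" --star pdf` (0); crossref "multilevel Monte Carlo coupling coarse
fine lattice field theory" (lattice-QCD
MLMC variance reduction, UV/numerical). OpenAlex/S2 rate-limited (429) — refuter please re-run
"common noise coupling Ising different
lattice spacing" remotely.
Nearest prior art found: Kozma2007 (§6: cross-mesh and commensurate-rotation COUPLING closes
existence + isotropy of 3D LERW; coupling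
object = the driving walk); doi:10.1214/16-AOP1088 and arXiv:14  [refs: 10.1214/16-AOP1088, 10.1142/S0219493720400067, 10.1214/24-AOP1690, 10.1214/17-AOP1212, 10.1214/13-AIHP591, 1411.1340, 2202.02301, doi:10.1214/16-AOP1088, doi:10.1142/S0219493720400067, doi:10.1214/24-AOP1690, doi:10.1214/17-AOP1212, doi:10.1214/13-AIHP591, Kozma2007]

Barriers (technique_class: sync-by-noise, cross-scale-joinings, coupling-cauchy): - technique_class: sync-by-noise, cross-scale-joinings, coupling-cauchy
- Literature.Barriers.CriticalPhenomena.RigorousRGSmallParameter: evaded — no expansion about a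
Gaussian fixed point and no small parameter: the joinings are couplings of the FULL critical measure
(κ is an auxiliary HS constant, not a coupling constant) and the small quantity b^(−θ) is the output
of a contraction property; conceded that DJ/RJ are strong-coupling statements with only Gaussian (θ
= 2), β = 0 (θ = 3) and same-equation (Gess–Tsatsoulis) anchors.
- Literature.Barriers.CriticalPhenomena.PositionSpaceRGNonGibbsian: evaded — no renormalisation map
on Hamiltonians or measures is ever defined: both marginals of every joining are exactly μ_c; only
block OBSERVABLES of the two copies are compared, so non-Gibbsianness of decimated/blocked measures
(van Enter–Fernández–Sokal Thms 4.1–4.3) has no object to act on.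
- Literature.Barriers.CriticalPhenomena.ScaleCovarianceNotMoebius: not engaged — the route never
upgrades Euclidean + scale data to inversion by a model-blind argument; inversion enters only
through the shared crux InversionUpgradeNormalised (typed with the normalisation its refutation file
prescribes), whose failure mode is declared in its why-line. Its lattice companion
(TwoPointLawNotMoebius.lean, class TwoPointLawMoebiusUpgradeFor) is evaded too: nothing is inferred
from a two-point law — the joinings control all block moments (all n) at once, and existence goes
through UniformRegularity +

History (route lifecycle, newest last):
- 2026-08-26T12:05:56Z · DORMANT — reconciler: no traction for 8 d (last activity item-evidence-added at 2026-08-18T11:10:31Z); parked, not closed — `ledger route dormant route-CriticalPhenomena- (operator:999:3983921)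

sub-problem: Ising3DConformalLimit · status: dormant · opened planner-plan-novel-CriticalPhenomena-Ising3DCon-3ad144fc-v2-g15-0 2026-08-17T02:59:19Z · rev 1 · ledger route-CriticalPhenomena-SynchronousCoupling
GENERATED by the gate from the ledger (D-0016/17). Provers cite these decls: `theorem foo : Summit.CriticalPhenomena.Ising3DConformalLimit.Theses.SynchronousCoupling.<Decl> := …` in Summits/CriticalPhenomena/Ising3DConformalLimit/Theorems/<Name>.lean.
-/

namespace Summit.CriticalPhenomena.Ising3DConformalLimit.Theses.SynchronousCoupling

open scoped BigOperators Topology Manifold Classical MeasureTheory ProbabilityTheory Matrix InnerProductSpace ComplexConjugate ContinuousMap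
open Filter Set Function TopologicalSpace MeasureTheory

attribute [summit_statement] _root_.Ising3DConformalLimit

/-- item stmt-CriticalPhenomena-18762 · crux · rank 2 · open · by planner
why it might fail: IR-black critical dynamics: the noise GENERATED per octave by the cubic vertex may be relevant, so no coupling beats a scale-independent defect (critic's toy, L ≤ 16: defect only ×0.85 per octave, r→1 vs saturation undecided); or joinings exist with o(1) defect but no power rate.
sources: Kozma2007, doi:10.1214/16-AOP1088, doi:10.1142/S0219493720400067, doi:10.1214/24-AOP1690, doi:10.1214/17-AOP1212, doi:10.1214/13-AIHP591
[crux] for the (unique, translation-invariant) critical Gibbs measure μ of the n.n. Ising model on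
ℤ³ and p ∈ {2,3} there are C, θ > 0 such that for every block side b ≥ 1 and window m there is a
coupling π of μ with μ under which, for every block index u with |u_i| ≤ m, the self-normalised
block spin of side p·b at corner p·b·u (copy 1) and the self-normalised block spin of side b at
corner b·u (copy 2) differ by at most C·b^(−θ) in L²(π) (card K1 at law level: "dilation is an
L²-approximate factor of μ_c"). [difficulty: open-problem] -/
@[route_item "route-CriticalPhenomena-SynchronousCoupling", crux]
def DilationJoinings : Prop :=
  ∀ μ ∈ Literature.Probability.LatticeModels.isingGibbsMeasures 3 (Literature.Probability.LatticeModels.criticalBeta 3) 0, Literature.Probability.LatticeModels.IsTranslationInvariantMeasure μ → ∀ p : ℕ, (p = 2 ∨ p = 3) → ∃ C θ : ℝ, 0 < θ ∧ ∀ b m : ℕ, 1 ≤ b → ∃ π : MeasureTheory.Measure (Literature.Probability.LatticeModels.SpinConfig (Literature.Probability.LatticeModels.Site 3) × Literature.Probability.LatticeModels.SpinConfig (Literature.Probability.LatticeModels.Site 3)), π.fst = μ ∧ π.snd = μ ∧ ∀ u : Fin 3 → ℤ, (∀ i, |u i| ≤ m) → ∫ q, ((Real.sqrt (∫ σ, (∑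 x ∈ Fintype.piFinset (fun _ : Fin 3 => Finset.Ico (0:ℤ) ((p:ℤ) * b)), Literature.Probability.LatticeModels.spinAt x σ) ^ 2 ∂μ))⁻¹ * (∑ x ∈ Fintype.piFinset (fun i : Fin 3 => Finset.Ico ((p:ℤ) * b * u i) ((p:ℤ) * b * u i + (p:ℤ) * b)), Literature.Probability.LatticeModels.spinAt x q.1) - (Real.sqrt (∫ σ, (∑ x ∈ Fintype.piFinset (fun _ : Fin 3 => Finset.Ico (0:ℤ) ((b:ℤ))), Literature.Probability.LatticeModels.spinAt x σ) ^ 2 ∂μ))⁻¹ * (∑ x ∈ Fintype.piFinset (fun i : Fin 3 => Finset.Ico ((b:ℤ) * u i) ((b:ℤ) * u i + (b:ℤ))), Literature.Probability.LatticeModels.spinAt x q.2)) ^ 2 ∂π ≤ C * (b : ℝ) ^ (-θ)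

/-- item stmt-CriticalPhenomena-18763 · crux · rank 3 · open · by planner
why it might fail: the rotated-cell/axis-cell mismatch is an O(1) UV perturbation renewed at every site and nothing lattice-exact protects it (commensurability is not used); if its generated noise is relevant the cross-correlation saturates below 1 and no power decay in n holds for any coupling.
sources: Kozma2007, arXiv:1811.11685, doi:10.1214/16-AOP1088, doi:10.1142/S0219493720400067, DuminilCopinICM2022
[crux] for μ as above there are C, θ > 0 such that for every n ≥ 1 and window m there is a coupling
π of μ with μ under which, for every block index u with |u_i| ≤ m, the self-normalised spin sum of
copy 1 over the lattice points x with A·x ∈ 3n(u + [0,1)³) (the cube n(u+[0,1)³) rotated by T⁻¹, T =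
A/3 ∈ SO(3)∖B₃, A = ((2,2,−1),(−1,2,2),(2,−1,2)), AᵀA = 9) and the self-normalised spin sum of copy
2 over the axis cube n(u + [0,1)³) differ by at most C·n^(−θ) in L²(π) (card K2: Kozma's
commensurate-rotation device with the walk replaced by common noise read through rotated cells,
equal clocks). [difficulty: open-problem] -/
@[route_item "route-CriticalPhenomena-SynchronousCoupling", crux]
def RotationJoining : Prop :=
  ∀ μ ∈ Literature.Probability.LatticeModels.isingGibbsMeasures 3 (Literature.Probability.LatticeModels.criticalBeta 3) 0, Literature.Probability.LatticeModels.IsTranslationInvariantMeasure μ → ∃ C θ : ℝ, 0 < θ ∧ ∀ n m : ℕ, 1 ≤ n → ∃ π : MeasureTheory.Measure (Literature.Probability.LatticeModels.SpinConfig (Literature.Probability.LatticeModels.Site 3) × Literature.Probability.LatticeModels.SpinConfig (Literature.Probability.LatticeModels.Site 3)), π.fst = μ ∧ π.snd = μ ∧ ∀ u : Fin 3 → ℤ, (∀ i, |u i| ≤ m) → ∫ q, ((Real.sqrt (∫ σ, (∑ x ∈ (Fintype.piFinset (fun _ : Fin 3 => Finset.Icc (-(2 * ((n:ℤ)) * ((m:ℤ)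 + 1))) (2 * ((n:ℤ)) * ((m:ℤ) + 1)))).filter (fun x => ∀ i, 0 ≤ Matrix.mulVec !![(2:ℤ), 2, -1; -1, 2, 2; 2, -1, 2] x i ∧ Matrix.mulVec !![(2:ℤ), 2, -1; -1, 2, 2; 2, -1, 2] x i < 3 * ((n:ℤ))), Literature.Probability.LatticeModels.spinAt x σ) ^ 2 ∂μ))⁻¹ * (∑ x ∈ (Fintype.piFinset (fun _ : Fin 3 => Finset.Icc (-(2 * ((n:ℤ)) * ((m:ℤ) + 1))) (2 * ((n:ℤ)) * ((m:ℤ) + 1)))).filter (fun x => ∀ i, 3 * ((n:ℤ)) * u i ≤ Matrix.mulVec !![(2:ℤ), 2, -1; -1, 2, 2; 2, -1, 2] x i ∧ Matrix.mulVec !![(2:ℤ), 2, -1; -1, 2, 2; 2, -1, 2] x i < 3 * ((n:ℤ)) * (u i + 1)), Literature.Probability.LatticeModels.spinAt x q.1) - (Real.sqrt (∫ σ, (∑ x ∈ Fintype.piFinset (fun _ : Fin 3 => Finset.Ico (0:ℤ) ((n:ℤ))), Literature.Probability.LatticeModels.spinAt x σ) ^ 2 ∂μ))⁻¹ * (∑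 x ∈ Fintype.piFinset (fun i : Fin 3 => Finset.Ico ((n:ℤ) * u i) ((n:ℤ) * u i + (n:ℤ))), Literature.Probability.LatticeModels.spinAt x q.2)) ^ 2 ∂π ≤ C * (n : ℝ) ^ (-θ)

/-- item stmt-CriticalPhenomena-4658 · crux · rank 4 · open · by planner
why it might fail: its open inputs are all-scale two-point doubling (6150: RP/MMS/IR admit crossover profiles breaking it) and equicontinuity at caged configurations (6152: needs a mixing input); SeparableHoelder and CompactnessGlue are proved, so it fails exactly if doubling or the caged modulus fails.
sources: AizenmanDuminilCopinAnnals2021, DuminilcopinPanis2025, MessagerMiracleSoleJSP1977, Newman1975Gaussian, Literature.Probability.LatticeModels.criticalTwoPoint_bounds_holds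
[crux] for every n and compact K ⊆ NonCoincident 3 n: (a) |F_δ(n,x)| ≤ M_K on K for all δ < δ₀(K);
(b) uniform equicontinuity: ∀ε>0 ∃r,δ₀>0 ∀δ<δ₀ ∀x,y∈K, dist x y < r → |F_δ(n,x) − F_δ(n,y)| < ε; (c)
n = 2: F_δ(2,x) ≥ m_K > 0 on K for δ < δ₀. Card item (1) (tightness + non-degeneracy of cluster
points). Engines foreseen: every-scale doubling g(2x) ≍ g(x) and Hölder regularity of rescaled
correlators uniformly in the scale (card every-scale-regular-multiplicative-fekete D1–D3; ADC21
regular scales), Newman's Gaussian inequality |⟨σ_A⟩| ≤ Σ_pairings Π⟨σσ⟩ for (a) at even n ≥ 4,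
m*(β_c)=0 (PROVED: spontaneousMagnetization_criticalBeta_eq_zero_holds) + GHS for odd n,
Messager–Miracle-Solé monotonicity for (c). [difficulty: open-problem] -/
@[route_item "route-CriticalPhenomena-SynchronousCoupling", crux]
def UniformRegularity : Prop :=
  (∀ (n : ℕ) (K : Set (Fin n → EuclideanSpace ℝ (Fin 3))), K ⊆ Literature.Probability.LatticeModels.NonCoincident 3 n → IsCompact K → (∃ M δ₀ : ℝ, 0 < δ₀ ∧ ∀ δ ∈ Set.Ioo 0 δ₀, ∀ x ∈ K, |Literature.Probability.LatticeModels.rescaledCorrelator (Literature.Probability.LatticeModels.criticalCorr 3) (fun δ : ℝ => (Literature.Probability.LatticeModels.criticalTwoPoint 3 (Pi.single 0 ⌊δ⁻¹⌋)) ^ (-(1/2:ℝ))) n δ x| ≤ M) ∧ (∀ ε : ℝ, 0 < ε → ∃ r δ₀ : ℝ, 0 < r ∧ 0 < δ₀ ∧ ∀ δ ∈ Set.Ioo 0 δ₀, ∀ x ∈ K, ∀ y ∈ K, dist x y < r → |Literature.Probability.LatticeModels.rescaledCorrelator (Literature.Probability.LatticeModels.criticalCorr 3) (fun δ : ℝ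 => (Literature.Probability.LatticeModels.criticalTwoPoint 3 (Pi.single 0 ⌊δ⁻¹⌋)) ^ (-(1/2:ℝ))) n δ x - Literature.Probability.LatticeModels.rescaledCorrelator (Literature.Probability.LatticeModels.criticalCorr 3) (fun δ : ℝ => (Literature.Probability.LatticeModels.criticalTwoPoint 3 (Pi.single 0 ⌊δ⁻¹⌋)) ^ (-(1/2:ℝ))) n δ y| < ε)) ∧ (∀ K : Set (Fin 2 → EuclideanSpace ℝ (Fin 3)), K ⊆ Literature.Probability.LatticeModels.NonCoincident 3 2 → IsCompact K → ∃ m δ₀ : ℝ, 0 < m ∧ 0 < δ₀ ∧ ∀ δ ∈ Set.Ioo 0 δ₀, ∀ x ∈ K, m ≤ Literature.Probability.LatticeModels.rescaledCorrelator (Literature.Probability.LatticeModels.criticalCorr 3) (fun δ : ℝ => (Literature.Probability.LatticeModels.criticalTwoPoint 3 (Pi.single 0 ⌊δ⁻¹⌋)) ^ (-(1/2:ℝ))) 2 δ x)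

/-- item stmt-CriticalPhenomena-18764 · crux · rank 5 · closed · proved by Summit.CriticalPhenomena.Ising3DConformalLimit.Cruxes.JoiningsTransfer.Sketch.JoiningsTransfer_proof @ e5a785e488f1 (prover) · by planner
why it might fail: only through the limit interchange b → ∞ before K → ∞ (needs C uniform in the window m — as typed — and equicontinuity uniform in δ from UR(b)); the O(3) step needs continuity of S_n on NonCoincident, again from UR(b): a bookkeeping risk, expected provable as filed.
sources: Kozma2007, Newman1975Gaussian, AizenmanDuminilCopinAnnals2021, Literature.Probability.LatticeModels.newman_evenMoment_le_holds, Literature.Probability.LatticeModels.exists_plusMeasure_holds, Literature.Barriers.CriticalPhenomena.ScaleNotMoebius.tendsto_rescaledCorrelator_unique_upToScalar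
[crux] the reduction: DilationJoinings → RotationJoining → UniformRegularity → (PL) ∧ (ROT), where
(PL) is item 6153's statement verbatim (for every n and non-coincident x the pinned rescaled
correlator converges as δ → 0⁺) and (ROT) says that every normalised, non-degenerate,
translation-invariant, scale-covariant pointwise scaling limit S of criticalCorr 3 is
IsRotationInvariant. Proof plan: block moments are Cauchy along b·p^j by the joinings + the PROVED
Newman Gaussian domination (newman_evenMoment_le_holds) and exists_plusMeasure_holds; the n = 2
joining at block separation K·e₀ exchanges the block normalisation for ρ★; UR(b) passes from blocks
to points and gives asymptotic log-scale continuity; log 2/log 3 ∉ ℚ gives the full filter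
(Kozma2007 §6); RJ + UR(b) give invariance of S under T and B₃, whose closure is O(3) (O_h is a
maximal finite subgroup, T ∉ O_h); two non-degenerate limits differ by κⁿ
(ScaleNotMoebius.tendsto_rescaledCorrelator_unique_upToScalar). [deps: DilationJoinings,
RotationJoining, UniformRegularity] [difficulty: L] -/
@[route_item "route-CriticalPhenomena-SynchronousCoupling", crux]
def JoiningsTransfer : Prop :=
  DilationJoinings → RotationJoining → UniformRegularity → (∀ (n : ℕ), ∀ x ∈ Literature.Probability.LatticeModels.NonCoincident 3 n, ∃ l : ℝ, Filter.Tendsto (fun δ : ℝ => Literature.Probability.LatticeModels.rescaledCorrelator (Literature.Probability.LatticeModels.criticalCorr 3) (fun δ : ℝ => (Literature.Probability.LatticeModels.criticalTwoPoint 3 (Pi.single 0 ⌊δ⁻¹⌋)) ^ (-(1/2:ℝ))) n δ x) (nhdsWithin 0 (Set.Ioi 0)) (nhds l)) ∧ (∀ (ρ : ℝ → ℝ) (Δ : ℝ) (S : Literature.Probability.LatticeModels.CorrFamily 3), (∀ δ ∈ Set.Ioc (0:ℝ) 1, 0 < ρ δ) → Literature.Probability.LatticeModels.HasPointwiseScalingLimit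 (Literature.Probability.LatticeModels.criticalCorr 3) ρ S → (∀ n z, z ∉ Literature.Probability.LatticeModels.NonCoincident 3 n → S n z = 0) → Literature.Probability.LatticeModels.IsNondegenerateTwoPoint S → Literature.Probability.LatticeModels.IsTranslationInvariant S → Literature.Probability.LatticeModels.IsScaleCovariant Δ S → Literature.Probability.LatticeModels.IsRotationInvariant S)

-- `JoiningsTransfer` holds: proved by `Summit.CriticalPhenomena.Ising3DConformalLimit.Cruxes.JoiningsTransfer.Sketch.JoiningsTransfer_proof` @ e5a785e488f1 (its module imports this route file, so no `_holds` link can be stated here).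

/-- item stmt-CriticalPhenomena-1982 · crux · rank 6 · open · by planner
why it might fail: scale + Euclid (+ RP) ⇏ inversion in general (free Maxwell d = 3, ElshowkNakayamaRychkov2011; witnessFamily of ScaleCovarianceNotMoebius); for Ising it rests on the absence of a Δ = 2 virial current, backed only by non-rigorous RG and Monte-Carlo Δ_V > 5.
sources: ElshowkNakayamaRychkov2011, Nakayama2015, DelamotteTissierWschebor2016, PolandRychkovVichi2019, Literature.Barriers.CriticalPhenomena.ScaleCovarianceNotMoebius
[crux r5, (D), inversion upgrade re-typed] Every pointwise scaling limit S of criticalCorr 3 (ρ > 0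
on (0,1]) that is normalised (S = 0 off NonCoincident), non-degenerate, Euclidean invariant and
scale covariant with Δ is IsInversionCovariant Δ (hence Möbius). This is (U) of route
IsingEuclidUpgrade (item 0637, refuted AS TYPED by not_inversionUpgrade_of_euclideanLimit through
values on the coincident locus) with the normalisation hypothesis the refutation file prescribes;
the model-blind version is false (Literature.Barriers.CriticalPhenomena.ScaleCovarianceNotMoebius;
free Maxwell d=3, ElshowkNakayamaRychkov2011), so any proof must use the Ising hypothesis (RP +
locality / absence of a dimension-2 virial current: DelamotteTissierWschebor2016 §5–6,
Nakayama2015). -/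
@[route_item "route-CriticalPhenomena-SynchronousCoupling", crux]
def InversionUpgradeNormalised : Prop :=
  ∀ (ρ : ℝ → ℝ) (Δ : ℝ) (S : Literature.Probability.LatticeModels.CorrFamily 3), (∀ δ ∈ Set.Ioc (0:ℝ) 1, 0 < ρ δ) → Literature.Probability.LatticeModels.HasPointwiseScalingLimit (Literature.Probability.LatticeModels.criticalCorr 3) ρ S → (∀ n z, z ∉ Literature.Probability.LatticeModels.NonCoincident 3 n → S n z = 0) → Literature.Probability.LatticeModels.IsNondegenerateTwoPoint S → Literature.Probability.LatticeModels.IsEuclideanInvariant S → Literature.Probability.LatticeModels.IsScaleCovariant Δ S → Literature.Probability.LatticeModels.IsInversionCovariant Δ S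

/-- item stmt-CriticalPhenomena-0636 · crux · rank 7 · open · by planner
why it might fail: non-triviality in d = 3 is open: U₄ ≢ 0 needs the double-current intersection probability at macroscopic separation to stay > 0 as δ → 0 (Aizenman1982); theorems in print go the other way (Gaussian limits for d = 4, ADC2021, and for RP long-range models on ℤ³, α ≤ 3/2).
sources: AizenmanDuminilCopinAnnals2021, Aizenman1982, DuminilCopinICM2022, Literature.Barriers.CriticalPhenomena.LongRangeTrivialityOnZ3, Literature.Barriers.CriticalPhenomena.IsingTrivialityFromDimensionFour
Crux r4 (non-triviality in d=3): every non-degenerate pointwise scaling limit S of the renormalised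
critical Ising correlators on Z^3 has connected four-point function U4 ≢ 0 on non-coincident
configurations. Intended tool: the random-current identity U4(x,y,z,t) =
−2⟨σxσy⟩⟨σzσt⟩·P^{xy,zt}[C_{n1+n2}(x) ∩ C_{n1+n2}(z) ≠ ∅] (Aizenman 1982; ADC2021 arXiv:1912.07973
eq. (3.11)): non-Gaussianity ⇔ the intersection probability of the two double-current clusters at
macroscopic separation does not vanish as δ → 0. Contrast: for d ≥ 4 every such limit IS Gaussian
(Literature.Probability.LatticeModels.highDim_triviality). Its negation refutes the conjunct
Ising3DConformalLimit itself. -/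
@[route_item "route-CriticalPhenomena-SynchronousCoupling", crux]
def IsingEuclidUpgradeR4NonGaussian : Prop :=
  ∀ (ρ : ℝ → ℝ) (S : Literature.Probability.LatticeModels.CorrFamily 3), (∀ δ ∈ Set.Ioc (0:ℝ) 1, 0 < ρ δ) → Literature.Probability.LatticeModels.HasPointwiseScalingLimit (Literature.Probability.LatticeModels.criticalCorr 3) ρ S → Literature.Probability.LatticeModels.IsNondegenerateTwoPoint S → Literature.Probability.LatticeModels.HasNontrivialU4 S

/-- item stmt-CriticalPhenomena-19086 · support · rank 9 · closed · proved by Summit.CriticalPhenomena.Ising3DConformalLimit.SynchronousCouplingPinnedLimitConstruction.pinnedLimitConstruction_proof @ 08bc5c5fbdf2 (prover) · by planner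
[support] GLUE, provable now in one line: (PL) → UniformRegularity → ∃ ρ Δ S, ρ > 0 on (0,1] ∧ 0 < Δ
∧ HasPointwiseScalingLimit (criticalCorr 3) ρ S ∧ S = 0 off NonCoincident ∧ IsNondegenerateTwoPoint
S ∧ IsTranslationInvariant S ∧ IsScaleCovariant Δ S, where (PL) is item 6153's statement verbatim
(pinned pointwise limit) and UniformRegularity is item 4658. This is the statement of the LANDED
theorem
Summit.CriticalPhenomena.Ising3DConformalLimit.MirrorHoelderLimitConstruction.limitConstruction_proof
(item 6159 of MirrorHoelderCompactness) with its two hypotheses swapped. Filed by route-repair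
(2026-08-17) so that the deciding theorem `closes` takes the limit construction as a hypothesis
instead of calling limitConstruction_proof, whose module
Theorems.MirrorHoelderCompactnessLimitConstruction dragged 45 unproved named Literature facts (lace
expansion barriers, Sweep1/InterfaceSLE, HighDimTriviality, ONModel specification) into this route
file's import cone although none is used. PROVER: `theorem … :
Summit.CriticalPhenomena.Ising3DConformalLimit.Theses.SynchronousCoupling.PinnedLimitConstruction :=
fun hPL hUR => Summit.CriticalPhenomena.Ising3DConformalLimit.MirrorHoelderLimitCon -/
@[route_item "route-CriticalPhenomena-SynchronousCoupling", crux]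
def PinnedLimitConstruction : Prop :=
  (∀ (n : ℕ), ∀ x ∈ Literature.Probability.LatticeModels.NonCoincident 3 n, ∃ l : ℝ, Filter.Tendsto (fun δ : ℝ => Literature.Probability.LatticeModels.rescaledCorrelator (Literature.Probability.LatticeModels.criticalCorr 3) (fun δ : ℝ => (Literature.Probability.LatticeModels.criticalTwoPoint 3 (Pi.single 0 ⌊δ⁻¹⌋)) ^ (-(1/2:ℝ))) n δ x) (nhdsWithin 0 (Set.Ioi 0)) (nhds l)) → UniformRegularity → ∃ (ρ : ℝ → ℝ) (Δ : ℝ) (S : Literature.Probability.LatticeModels.CorrFamily 3), (∀ δ ∈ Set.Ioc (0:ℝ) 1, 0 < ρ δ) ∧ 0 < Δ ∧ Literature.Probability.LatticeModels.HasPointwiseScalingLimit (Literature.Probability.LatticeModels.criticalCorr 3) ρ S ∧ (∀ n z, z ∉ Literature.Probability.LatticeModels.NonCoincident 3 n → S n z = 0) ∧ Literature.Probability.LatticeModels.IsNondegenerateTwoPoint S ∧ Literature.Probability.LatticeModels.IsTranslationInvariant S ∧ Literature.Probability.LatticeModels.IsScaleCovariant Δ S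

-- `PinnedLimitConstruction` holds: proved by `Summit.CriticalPhenomena.Ising3DConformalLimit.SynchronousCouplingPinnedLimitConstruction.pinnedLimitConstruction_proof` @ 08bc5c5fbdf2 (its module imports this route file, so no `_holds` link can be stated here).

/-- item stmt-CriticalPhenomena-18765 · assembly · rank 1 · open · by planner
sources: Kozma2007, DuminilCopinICM2022, ChelkakHonglerIzyurov2015
[assembly] DilationJoinings → RotationJoining → UniformRegularity → JoiningsTransfer →
InversionUpgradeNormalised → IsingEuclidUpgradeR4NonGaussian → the sub-problem statement. -/
@[route_item "route-CriticalPhenomena-SynchronousCoupling"]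
def Assembly : Prop :=
  DilationJoinings → RotationJoining → UniformRegularity → JoiningsTransfer → InversionUpgradeNormalised → IsingEuclidUpgradeR4NonGaussian → _root_.Ising3DConformalLimit

/-! D-0027 §2.1 — DECIDING THEOREM (planner-authored via `route open/edit --closes-file`; by planner-rrepair-CriticalPhenomena-SynchronousC-cd3b6769-0 2026-08-17T03:51:55Z):
its hypotheses are this route's items and its conclusion the sub-problem Statement (glue_lint), and it elaborates with this file. -/

@[closes "route-CriticalPhenomena-SynchronousCoupling"] theorem closes : DilationJoinings → RotationJoining → UniformRegularity → JoiningsTransfer → InversionUpgradeNormalised → IsingEuclidUpgradeR4NonGaussian → PinnedLimitConstruction → _root_.Ising3DConformalLimit := by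
  intro hDJ hRJ hUR hT hIU hNG hLC
  obtain ⟨hPL, hRot⟩ := hT hDJ hRJ hUR
  obtain ⟨ρ, Δ, S, hρ, hΔ, hlim, hnorm, hnd, htr, hsc⟩ := hLC hPL hUR
  have hrot : Literature.Probability.LatticeModels.IsRotationInvariant S := hRot ρ Δ S hρ hlim hnorm hnd htr hsc
  have hE : Literature.Probability.LatticeModels.IsEuclideanInvariant S := ⟨htr, hrot⟩
  have hI : Literature.Probability.LatticeModels.IsInversionCovariant Δ S := hIU ρ Δ S hρ hlim hnorm hnd hE hsc
  exact ⟨ρ, Δ, S, hρ, hΔ, hlim, hnd, ⟨hE, hsc, hI⟩, hNG ρ S hρ hlim hnd⟩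

end Summit.CriticalPhenomena.Ising3DConformalLimit.Theses.SynchronousCoupling
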